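import Summits.QuantumFields.YangMills.Theorems.VirialFluxGapFixSliceChartV
import Summits.QuantumFields.YangMills.Theorems.VirialFluxGapFixGaugeAction
import Summits.QuantumFields.YangMills.Theorems.VirialFluxGapAnchorSliceAlgebra
import Summits.QuantumFields.YangMills.Theorems.VirialFluxGapProductSincWeight
import HarnessLib

/-!
# The structural hypotheses of the orbit-tube Laplace theorem on `X_fix`: slice map, `hΘ'`, `hslice`, `hfix`, `hT`, `hA`, `hJint`, `hc0`, `hctop`
# (layer (B2) of the DIRECT Laplace road to ⟨stmt-QuantumFields-24204⟩ `VirialFluxGap.SharpTwistedLaplace`)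

Helper module (free-hands work of width seat ym-line-sfw-p2-w3 g57, cell ym-idea-1; `--supports 24204`).  For
✓`QuantitativeLaplace.laplaceMethod_quantitative_orbit_tube` on `X = X_fix(L)` with `K = SU(2)` acting by the residual constant gauge
transformation of ✓`VirialFluxGapFixGaugeAction` (`act`, written inline as there), `V = ℝ^{fixDim}`, `σ(y) = fixSlice(fixCoord y)`, `Z = ℝ³`,
`e = expPoint`, `Θ'(z, y) = fixWindowMap(z, fixCoord y)`, `S = {1, −1}`, `ν = Haar probability`:
* §1 `fixWindowMap_eq_act` (`hΘ'`: `Θ'(z, y) = act (e z) (σ y)` — by `rfl`), `fixSlice_seam ∕ fixSlice_link` (the anchor components of `σ`),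
  `continuous_fixSlice`, `measurable_fixSlice` (`hσ`);
* §2 ★ `fix_hslice` — `act k (σ y) = σ y'` with `‖y‖, ‖y'‖ ≤ R_V < 1` forces `k ∈ {1, −1}` (✓`su2_eq_one_or_negOne_of_conj_anchor_pair` on the two
  anchors); `fix_hfix` — `±1` act trivially;
* §3 `fix_hT` (the tube `Θ(K × B̄)` is compact hence measurable), `fix_hA` (Lusin–Souslin), `fix_hJint` (bounded density on a bounded window);
* §4 `expMeasure_closedBall_pos`, ★ `fix_hc0` ∕ `fix_hctop` — `0 < ν(((e(B̄_{r₀}))·S)⁻¹) < ∞`.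
With ✓`fix_hloc` (…FixSliceChartV), ✓`exists_fix_window_datum` (…FixWindowDatum) and ✓`measurable_fixGaugeAct ∕ fixGaugeAct_mul ∕ fixGaugeAct_one ∕
measurePreserving_fixGaugeAct ∕ ringDeficit_fix_fixGaugeAct` (…FixGaugeAction) this discharges EVERY structural hypothesis of the orbit theorem on
`X_fix`; what remains is the ANALYTIC data along the slice (`hf`: quadratic form `A`, cubic∕quartic remainders from ✓`RingChartPhase`; coercivity
`λ ≥ 1/poly(L)`; the window inequalities; `f(σ 0) = 0`) and the off-tube floor.
Everything here is PROVED; no definitions, no named facts.  HONEST FRAMING: structural bookkeeping; ⟨24204⟩, ⟨24319⟩ and every rung stay OPEN;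
the Yang–Mills mass gap (Clay) is NOT touched; no summit is proved by a line.

## References
* G. E. Bredon, *Introduction to Compact Transformation Groups* (1972), Ch. II §§4–5. [Bredon1972]
* S. Helgason, *Groups and Geometric Analysis* (2000), Ch. I §1 Thm 1.14. [Helgason2000]
* K. W. Breitung, *Asymptotic Approximations for Probability Integrals*, LNM 1592 (1994), §2.3; Thm 41 p. 56. [Breitung1994]
-/

set_option autoImplicit false

noncomputable section

open MeasureTheory Set Filter Metric WithLp
open scoped ENNReal RealInnerProductSpace Pointwise
open Literature.MathematicalPhysics.QuantumLattice
open Literature.MathematicalPhysics.QuantumFieldTheory hiding SU2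
open Literature.MathematicalPhysics.QuantumFieldTheory.Balaban1983to89.T4HaarSU2ExpChart
open Literature.MathematicalPhysics.QuantumFieldTheory.Balaban1983to89.T4ExpWindowSmallField
open Summit.QuantumFields.YangMills.Theorems.FemtoTransferGap
open Summit.QuantumFields.YangMills.Theorems.FemtoTransferGap.TT
open Summit.QuantumFields.YangMills.Theorems.VirialFluxGap.AnchorSlice
open Summit.QuantumFields.YangMills.Theorems.VirialFluxGap.ConjChart
open Summit.QuantumFields.YangMills.Theorems.VirialFluxGap.ChartWeight

namespace Summit.QuantumFields.YangMills.Theorems.VirialFluxGap.FixSplit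

variable {L : ℕ} [NeZero L] {e₀ : OffIdx L} {y₀ : Site 3 L}

/-! ## §1 The slice map and the window map as `act (e z) (σ y)` -/

omit [NeZero L] in
/-- **`hΘ'`**: `Θ'(z, p) = act (expPoint z) (σ p)` with the residual action of ✓`VirialFluxGapFixGaugeAction` (definitional).
[cite: Bredon1972, Ch. II §§4–5] -/
theorem fixWindowMap_eq_act (ωC ωN ωX : EuclideanSpace ℝ (Fin 3)) (C₀ N₀ : SU2) (R : FixRest L e₀ y₀)
    (z : EuclideanSpace ℝ (Fin 3)) (p : EuclideanSpace ℝ (Fin 3) × RestParam L e₀ y₀) :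
    fixWindowMap ωC ωN ωX C₀ N₀ R (z, p) =
      (((fun i => expPoint z * (fixSlice ωC ωN ωX C₀ N₀ R p).1 i * (expPoint z)⁻¹),
        ((fun j => gaugeTransform (fun _ : Site 3 L => expPoint z) ((fixSlice ωC ωN ωX C₀ N₀ R p).2.1 j)),
          (fun y => expPoint z * (fixSlice ωC ωN ωX C₀ N₀ R p).2.2 y * (expPoint z)⁻¹))) :
        (OffIdx L → SU2) × ((Fin (2 * L - 1) → GaugeConfig 3 L SU2) × (Site 3 L → SU2))) := rfl

omit [NeZero L] in
/-- The seam component of the slice point is `seamSlice(a₀)`. [folklore] -/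
theorem fixSlice_seam (ωC ωN ωX : EuclideanSpace ℝ (Fin 3)) (C₀ N₀ : SU2) (R : FixRest L e₀ y₀)
    (p : EuclideanSpace ℝ (Fin 3) × RestParam L e₀ y₀) : (fixSlice ωC ωN ωX C₀ N₀ R p).2.2 y₀ = seamSlice ωC C₀ (p.1 0) := by
  show (if h : y₀ = y₀ then _ else _) = _
  rw [dif_pos rfl]

omit [NeZero L] in
/-- The off-tree anchor component of the slice point is `linkSlice(a₁, a₂)`. [folklore] -/
theorem fixSlice_link (ωC ωN ωX : EuclideanSpace ℝ (Fin 3)) (C₀ N₀ : SU2) (R : FixRest L e₀ y₀)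
    (p : EuclideanSpace ℝ (Fin 3) × RestParam L e₀ y₀) : (fixSlice ωC ωN ωX C₀ N₀ R p).1 e₀ = linkSlice ωN ωX N₀ (p.1 1) (p.1 2) := by
  show (if h : e₀ = e₀ then _ else _) = _
  rw [dif_pos rfl]

omit [NeZero L] in
/-- The slice map is continuous. [folklore] -/
theorem continuous_fixSlice (ωC ωN ωX : EuclideanSpace ℝ (Fin 3)) (C₀ N₀ : SU2) (R : FixRest L e₀ y₀) :
    Continuous (fixSlice ωC ωN ωX C₀ N₀ R) := by
  have hc : ∀ i : Fin 3, Continuous fun p : EuclideanSpace ℝ (Fin 3) × RestParam L e₀ y₀ => p.1 i := fun i =>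
    (EuclideanSpace.proj i : EuclideanSpace ℝ (Fin 3) →L[ℝ] ℝ).continuous.comp continuous_fst
  have hseam : Continuous fun p : EuclideanSpace ℝ (Fin 3) × RestParam L e₀ y₀ => seamSlice ωC C₀ (p.1 0) :=
    (continuous_expPoint.comp ((hc 0).smul continuous_const)).mul continuous_const
  have hlink : Continuous fun p : EuclideanSpace ℝ (Fin 3) × RestParam L e₀ y₀ => linkSlice ωN ωX N₀ (p.1 1) (p.1 2) :=
    (continuous_expPoint.comp (((hc 1).smul continuous_const).add ((hc 2).smul continuous_const))).mul continuous_const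
  have hrest : Continuous fun p : EuclideanSpace ℝ (Fin 3) × RestParam L e₀ y₀ => restChart R 1 p.2 := by
    have h := (continuous_restChart_param R).comp
      ((continuous_const : Continuous fun _ : EuclideanSpace ℝ (Fin 3) × RestParam L e₀ y₀ => (0 : EuclideanSpace ℝ (Fin 3))).prodMk
        continuous_snd)
    have he : (Function.uncurry fun (z : EuclideanSpace ℝ (Fin 3)) (b : RestParam L e₀ y₀) => restChart R (expPoint z) b) ∘
        (fun p : EuclideanSpace ℝ (Fin 3) × RestParam L e₀ y₀ => ((0 : EuclideanSpace ℝ (Fin 3)), p.2)) =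
        fun p => restChart R 1 p.2 := by
      funext p
      simp only [Function.comp_apply, Function.uncurry_apply_pair, expPoint_zero]
    rw [he] at h
    exact h
  unfold fixSlice
  exact continuous_fixSplit_symm.comp ((hseam.prodMk hlink).prodMk hrest)

omit [NeZero L] in
/-- **`hσ`**: the slice map is measurable. [folklore] -/
theorem measurable_fixSlice (ωC ωN ωX : EuclideanSpace ℝ (Fin 3)) (C₀ N₀ : SU2) (R : FixRest L e₀ y₀) :
    Measurable (fixSlice ωC ωN ωX C₀ N₀ R) := by
  have h1 : fixSlice ωC ωN ωX C₀ N₀ R = fun p => fixWindowMap ωC ωN ωX C₀ N₀ R (0, p) := by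
    funext p
    rw [fixWindowMap_eq_act, expPoint_zero]
    exact (RingDeficit.fixGaugeAct_one _).symm
  rw [h1]
  exact (measurable_fixWindowMap ωC ωN ωX C₀ N₀ R).comp (measurable_const.prodMk measurable_id)

/-- The Euclidean slice `σ(y) = fixSlice(fixCoord y)` is measurable and continuous. [folklore] -/
theorem measurable_fixSlice_fixCoord (ωC ωN ωX : EuclideanSpace ℝ (Fin 3)) (C₀ N₀ : SU2) (R : FixRest L e₀ y₀) :
    Measurable fun y : EuclideanSpace ℝ (Fin (fixDim L e₀ y₀)) => fixSlice ωC ωN ωX C₀ N₀ R (fixCoord y) :=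
  (measurable_fixSlice ωC ωN ωX C₀ N₀ R).comp measurable_fixCoord


/-- **`hΘm`**: the tube map `Θ(k, y) = k · σ(y)` is measurable. [folklore] -/
theorem fix_hΘm (ωC ωN ωX : EuclideanSpace ℝ (Fin 3)) (C₀ N₀ : SU2) (R : FixRest L e₀ y₀) :
    Measurable fun q : SU2 × EuclideanSpace ℝ (Fin (fixDim L e₀ y₀)) =>
      (((fun i => q.1 * (fixSlice ωC ωN ωX C₀ N₀ R (fixCoord q.2)).1 i * q.1⁻¹),
        ((fun j => gaugeTransform (fun _ : Site 3 L => q.1) ((fixSlice ωC ωN ωX C₀ N₀ R (fixCoord q.2)).2.1 j)),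
          (fun s => q.1 * (fixSlice ωC ωN ωX C₀ N₀ R (fixCoord q.2)).2.2 s * q.1⁻¹))) :
        (OffIdx L → SU2) × ((Fin (2 * L - 1) → GaugeConfig 3 L SU2) × (Site 3 L → SU2))) := by
  have h := Measurable.comp
    (g := fun p : SU2 × ((OffIdx L → SU2) × ((Fin (2 * L - 1) → GaugeConfig 3 L SU2) × (Site 3 L → SU2))) =>
      ((((fun i => p.1 * p.2.1 i * p.1⁻¹),
        ((fun j => gaugeTransform (fun _ : Site 3 L => p.1) (p.2.2.1 j)), (fun s => p.1 * p.2.2.2 s * p.1⁻¹))) :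
          (OffIdx L → SU2) × ((Fin (2 * L - 1) → GaugeConfig 3 L SU2) × (Site 3 L → SU2)))))
    (f := fun q : SU2 × EuclideanSpace ℝ (Fin (fixDim L e₀ y₀)) => (q.1, fixSlice ωC ωN ωX C₀ N₀ R (fixCoord q.2)))
    RingDeficit.measurable_fixGaugeAct (measurable_fst.prodMk ((measurable_fixSlice_fixCoord ωC ωN ωX C₀ N₀ R).comp measurable_snd))
  exact h

/-- **`hΘ'm`**: the Euclidean window map `Θ'(z, y) = fixWindowMap(z, fixCoord y)` is measurable. [folklore] -/
theorem fix_hΘ'm (ωC ωN ωX : EuclideanSpace ℝ (Fin 3)) (C₀ N₀ : SU2) (R : FixRest L e₀ y₀) :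
    Measurable fun w : EuclideanSpace ℝ (Fin 3) × EuclideanSpace ℝ (Fin (fixDim L e₀ y₀)) => fixWindowMap ωC ωN ωX C₀ N₀ R (w.1, fixCoord w.2) :=
  (measurable_fixWindowMap ωC ωN ωX C₀ N₀ R).comp (measurable_fst.prodMk (measurable_fixCoord.comp measurable_snd))

/-- **`hJm`**: the density `J(z, y) = restWeight(b(y)) · anchorDensity(z, a(y))` is measurable. [folklore] -/
theorem fix_hJm (ωC ωN ωX : EuclideanSpace ℝ (Fin 3)) (C₀ N₀ : SU2) :
    Measurable fun w : EuclideanSpace ℝ (Fin 3) × EuclideanSpace ℝ (Fin (fixDim L e₀ y₀)) =>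
      restWeight (fixCoord w.2).2 * anchorDensity ωC ωN ωX C₀ N₀ (w.1, (fixCoord w.2).1) :=
  (measurable_restWeight.comp (measurable_snd.comp (measurable_fixCoord.comp measurable_snd))).mul
    (measurable_anchorDensity.comp (measurable_fst.prodMk (measurable_fst.comp (measurable_fixCoord.comp measurable_snd))))

/-! ## §2 The slice hypotheses `hslice` and `hfix` with `S = {1, −1}` -/

omit [NeZero L] in
/-- A coordinate of a Euclidean vector is bounded by its norm. [folklore] -/
theorem abs_apply_le_norm (a : EuclideanSpace ℝ (Fin 3)) (i : Fin 3) : |a i| ≤ ‖a‖ := by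
  have h := PiLp.norm_apply_le a i
  rwa [Real.norm_eq_abs] at h

/-- ★ **`hslice`**: if `k · σ(y) = σ(y')` with `‖y‖, ‖y'‖ ≤ R_V < 1` then `k = ±1` (the stabiliser test on the two anchors,
✓`su2_eq_one_or_negOne_of_conj_anchor_pair`). [cite: Bredon1972, Ch. II §§4–5] -/
theorem fix_hslice {ωC ωN ωX : EuclideanSpace ℝ (Fin 3)} {C₀ N₀ : SU2} (hC : ‖ωC‖ = 1) (hN : ‖ωN‖ = 1)
    (hCN : ⟪ωC, ωN⟫ = 0) (hX : imQuat ωX = imQuat ωC * imQuat ωN) (hC₀ : su2Quat C₀ = imQuat ωC)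
    (hN₀ : su2Quat N₀ = imQuat ωN ∨ su2Quat N₀ = -imQuat ωN) (R : FixRest L e₀ y₀) {Rv : ℝ} (hRv : Rv < 1) (k : SU2)
    (y : EuclideanSpace ℝ (Fin (fixDim L e₀ y₀))) (hy : y ∈ closedBall (0 : EuclideanSpace ℝ (Fin (fixDim L e₀ y₀))) Rv)
    (y' : EuclideanSpace ℝ (Fin (fixDim L e₀ y₀))) (hy' : y' ∈ closedBall (0 : EuclideanSpace ℝ (Fin (fixDim L e₀ y₀))) Rv)
    (h : (((fun i => k * (fixSlice ωC ωN ωX C₀ N₀ R (fixCoord y)).1 i * k⁻¹),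
        ((fun j => gaugeTransform (fun _ : Site 3 L => k) ((fixSlice ωC ωN ωX C₀ N₀ R (fixCoord y)).2.1 j)),
          (fun s => k * (fixSlice ωC ωN ωX C₀ N₀ R (fixCoord y)).2.2 s * k⁻¹))) :
        (OffIdx L → SU2) × ((Fin (2 * L - 1) → GaugeConfig 3 L SU2) × (Site 3 L → SU2))) =
      fixSlice ωC ωN ωX C₀ N₀ R (fixCoord y')) :
    k ∈ ({1, negOne} : Set SU2) := by
  have hπ : (1 : ℝ) < Real.pi / 2 := by linarith [Real.pi_gt_three]
  have hya : ‖(fixCoord y).1‖ < Real.pi / 2 :=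
    lt_of_le_of_lt ((norm_fixCoord_fst_le y).trans (mem_closedBall_zero_iff.1 hy)) (hRv.trans hπ)
  have hya' : ‖(fixCoord y').1‖ < Real.pi / 2 :=
    lt_of_le_of_lt ((norm_fixCoord_fst_le y').trans (mem_closedBall_zero_iff.1 hy')) (hRv.trans hπ)
  have hπ0 : 0 < Real.pi / 2 := by positivity
  have h1 := congrArg (fun x : (OffIdx L → SU2) × ((Fin (2 * L - 1) → GaugeConfig 3 L SU2) × (Site 3 L → SU2)) => x.2.2 y₀) h
  have h2 := congrArg (fun x : (OffIdx L → SU2) × ((Fin (2 * L - 1) → GaugeConfig 3 L SU2) × (Site 3 L → SU2)) => x.1 e₀) h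
  simp only [fixSlice_seam, fixSlice_link] at h1 h2
  have hk := su2_eq_one_or_negOne_of_conj_anchor_pair hC hN hCN hX hC₀ hN₀ k
    (t := (fixCoord y).1 0) (t' := (fixCoord y').1 0) (b₁ := (fixCoord y).1 1) (b₂ := (fixCoord y).1 2)
    (b₁' := (fixCoord y').1 1) (b₂' := (fixCoord y').1 2)
    (lt_of_le_of_lt (abs_apply_le_norm _ 0) hya) (lt_of_le_of_lt (abs_apply_le_norm _ 0) hya')
    (lt_of_le_of_lt (sq_add_sq_le_norm_sq _) (by nlinarith [norm_nonneg (fixCoord y).1]))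
    (lt_of_le_of_lt (sq_add_sq_le_norm_sq _) (by nlinarith [norm_nonneg (fixCoord y').1])) h1 h2
  simp only [Set.mem_insert_iff, Set.mem_singleton_iff]
  exact hk

omit [NeZero L] in
/-- **`hfix`**: `±1` act trivially on `X_fix`. [folklore] -/
theorem fix_hfix (s : SU2) (hs : s ∈ ({1, negOne} : Set SU2))
    (x : (OffIdx L → SU2) × ((Fin (2 * L - 1) → GaugeConfig 3 L SU2) × (Site 3 L → SU2))) :
    (((fun i => s * x.1 i * s⁻¹), ((fun j => gaugeTransform (fun _ : Site 3 L => s) (x.2.1 j)), (fun y => s * x.2.2 y * s⁻¹))) :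
        (OffIdx L → SU2) × ((Fin (2 * L - 1) → GaugeConfig 3 L SU2) × (Site 3 L → SU2))) = x := by
  have hcomm : ∀ g : SU2, s * g * s⁻¹ = g := by
    intro g
    simp only [Set.mem_insert_iff, Set.mem_singleton_iff] at hs
    rcases hs with rfl | rfl
    · simp
    · rw [negOne_mul_comm, mul_inv_cancel_right]
  refine Prod.ext ?_ (Prod.ext ?_ ?_)
  · funext i; exact hcomm _
  · funext j e; simp only [gaugeTransform]; exact hcomm _
  · funext y; exact hcomm _

/-! ## §3 Measurability of the tube and of the window image; integrability of the density -/

/-- **`hT`**: the tube `Θ(SU(2) × B̄_{R_V})` is compact, hence measurable. [cite: Bredon1972, Ch. II §§4–5] -/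
theorem fix_hT (ωC ωN ωX : EuclideanSpace ℝ (Fin 3)) (C₀ N₀ : SU2) (R : FixRest L e₀ y₀) (Rv : ℝ) :
    MeasurableSet ((fun q : SU2 × EuclideanSpace ℝ (Fin (fixDim L e₀ y₀)) =>
      (((fun i => q.1 * (fixSlice ωC ωN ωX C₀ N₀ R (fixCoord q.2)).1 i * q.1⁻¹),
        ((fun j => gaugeTransform (fun _ : Site 3 L => q.1) ((fixSlice ωC ωN ωX C₀ N₀ R (fixCoord q.2)).2.1 j)),
          (fun s => q.1 * (fixSlice ωC ωN ωX C₀ N₀ R (fixCoord q.2)).2.2 s * q.1⁻¹))) :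
        (OffIdx L → SU2) × ((Fin (2 * L - 1) → GaugeConfig 3 L SU2) × (Site 3 L → SU2)))) ''
      ((univ : Set SU2) ×ˢ closedBall (0 : EuclideanSpace ℝ (Fin (fixDim L e₀ y₀))) Rv)) := by
  haveI : OpensMeasurableSpace ((Fin (2 * L - 1) → GaugeConfig 3 L SU2) × (Site 3 L → SU2)) := Prod.opensMeasurableSpace
  haveI : OpensMeasurableSpace (FixSpace L) := Prod.opensMeasurableSpace
  have hσc : Continuous fun y : EuclideanSpace ℝ (Fin (fixDim L e₀ y₀)) => fixSlice ωC ωN ωX C₀ N₀ R (fixCoord y) :=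
    (continuous_fixSlice ωC ωN ωX C₀ N₀ R).comp continuous_fixCoord
  have hq : Continuous fun q : SU2 × EuclideanSpace ℝ (Fin (fixDim L e₀ y₀)) => (q.1, fixSlice ωC ωN ωX C₀ N₀ R (fixCoord q.2)) :=
    continuous_fst.prodMk (hσc.comp continuous_snd)
  have hΘc := (RingDeficit.continuous_fixGaugeAct (L := L)).comp hq
  exact ((isCompact_univ.prod (isCompact_closedBall _ _)).image hΘc).isClosed.measurableSet

/-- **`hA`**: the window image `Θ'(Φ × B̄_{R_V})` is measurable (Lusin–Souslin). [cite: Breitung1994, §2.3 Definitions 4–5] -/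
theorem fix_hA {ωC ωN ωX : EuclideanSpace ℝ (Fin 3)} {C₀ N₀ : SU2} (hC : ‖ωC‖ = 1) (hN : ‖ωN‖ = 1)
    (hCN : ⟪ωC, ωN⟫ = 0) (hX : imQuat ωX = imQuat ωC * imQuat ωN) (hC₀ : su2Quat C₀ = imQuat ωC)
    (hN₀ : su2Quat N₀ = imQuat ωN ∨ su2Quat N₀ = -imQuat ωN) (R : FixRest L e₀ y₀) {Φ : Set (EuclideanSpace ℝ (Fin 3))}
    (hΦm : MeasurableSet Φ) {r : ℝ} (hr : r < Real.pi / 2) (hΦ : Φ ⊆ closedBall (0 : EuclideanSpace ℝ (Fin 3)) r) {Rv : ℝ} (hRv : Rv < 1) :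
    MeasurableSet ((fun w : EuclideanSpace ℝ (Fin 3) × EuclideanSpace ℝ (Fin (fixDim L e₀ y₀)) => fixWindowMap ωC ωN ωX C₀ N₀ R (w.1, fixCoord w.2)) ''
      (Φ ×ˢ closedBall (0 : EuclideanSpace ℝ (Fin (fixDim L e₀ y₀))) Rv)) := by
  haveI : OpensMeasurableSpace ((Fin (2 * L - 1) → GaugeConfig 3 L SU2) × (Site 3 L → SU2)) := Prod.opensMeasurableSpace
  haveI : OpensMeasurableSpace (FixSpace L) := Prod.opensMeasurableSpace
  have hRvπ : Rv < Real.pi := by linarith [Real.pi_gt_three]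
  have hΨinj : Function.Injective (Prod.map (id : EuclideanSpace ℝ (Fin 3) → EuclideanSpace ℝ (Fin 3))
      (fixCoord (L := L) (e₀ := e₀) (y₀ := y₀))) :=
    Function.injective_id.prodMap fixCoord_injective
  have hΨW : Prod.map (id : EuclideanSpace ℝ (Fin 3) → EuclideanSpace ℝ (Fin 3)) (fixCoord (L := L) (e₀ := e₀) (y₀ := y₀)) ''
      (Φ ×ˢ closedBall 0 Rv) ⊆
      closedBall (0 : EuclideanSpace ℝ (Fin 3)) r ×ˢ (closedBall (0 : EuclideanSpace ℝ (Fin 3)) Rv ×ˢ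
      ((Set.pi univ fun _ : {i : OffIdx L // ¬ i = e₀} =>
        (ball (0 : EuclideanSpace ℝ (Fin 3)) Real.pi ∪ {(Real.pi : ℝ) • EuclideanSpace.single (0 : Fin 3) (1 : ℝ)})) ×ˢ
      ((Set.pi univ fun _ : Fin (2 * L - 1) => Set.pi univ fun _ : Edge 3 L =>
        (ball (0 : EuclideanSpace ℝ (Fin 3)) Real.pi ∪ {(Real.pi : ℝ) • EuclideanSpace.single (0 : Fin 3) (1 : ℝ)})) ×ˢ
      (Set.pi univ fun _ : {y : Site 3 L // ¬ y = y₀} =>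
        (ball (0 : EuclideanSpace ℝ (Fin 3)) Real.pi ∪ {(Real.pi : ℝ) • EuclideanSpace.single (0 : Fin 3) (1 : ℝ)}))))) := by
    rintro _ ⟨⟨z, y⟩, ⟨hz, hy⟩, rfl⟩
    have hyR : ‖y‖ ≤ Rv := mem_closedBall_zero_iff.1 hy
    have hb : ∀ x : EuclideanSpace ℝ (Fin 3), ‖x‖ ≤ ‖y‖ →
        x ∈ ball (0 : EuclideanSpace ℝ (Fin 3)) Real.pi ∪ {(Real.pi : ℝ) • EuclideanSpace.single (0 : Fin 3) (1 : ℝ)} := fun x hx =>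
      ball_subset_expDomain (mem_ball_zero_iff.2 (lt_of_le_of_lt (hx.trans hyR) hRvπ))
    refine ⟨hΦ hz, ⟨mem_closedBall_zero_iff.2 ((norm_fixCoord_fst_le y).trans hyR), ?_⟩⟩
    exact ⟨fun i _ => hb _ (norm_fixCoord_snd_fst_le y i), fun j _ e _ => hb _ (norm_fixCoord_snd_snd_fst_le y j e),
      fun s _ => hb _ (norm_fixCoord_snd_snd_snd_le y s)⟩
  have hinjW : InjOn (fixWindowMap ωC ωN ωX C₀ N₀ R ∘ Prod.map (id : EuclideanSpace ℝ (Fin 3) → EuclideanSpace ℝ (Fin 3)) fixCoord)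
      (Φ ×ˢ closedBall 0 Rv) :=
    (injOn_fixWindowMap hC hN hCN hX hC₀ hN₀ R hr hRv).comp hΨinj.injOn fun w hw => hΨW (mem_image_of_mem _ hw)
  exact (hΦm.prod measurableSet_closedBall).image_of_continuousOn_injOn
    (((continuous_fixWindowMap ωC ωN ωX C₀ N₀ R).comp (continuous_id.prodMap continuous_fixCoord)).continuousOn) hinjW

/-- **`hJint`**: the density `z ↦ restWeight(b(y)) · anchorDensity(z, a(y))` is integrable on every measurable `Φ ⊆ closedBall 0 r` for
`‖y‖ ≤ R_V < 1`. [cite: Breitung1994, §2.3 Definitions 4–5] -/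
theorem fix_hJint {ωC ωN ωX : EuclideanSpace ℝ (Fin 3)} {C₀ N₀ : SU2} (hC : ‖ωC‖ = 1) (hN : ‖ωN‖ = 1)
    (hCN : ⟪ωC, ωN⟫ = 0) (hX : imQuat ωX = imQuat ωC * imQuat ωN) (hC₀ : su2Quat C₀ = imQuat ωC)
    (hN₀ : su2Quat N₀ = imQuat ωN ∨ su2Quat N₀ = -imQuat ωN) {Φ : Set (EuclideanSpace ℝ (Fin 3))}
    (hΦm : MeasurableSet Φ) {r : ℝ} (hΦ : Φ ⊆ closedBall (0 : EuclideanSpace ℝ (Fin 3)) r) {Rv : ℝ} (hRv : Rv < 1)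
    (y : EuclideanSpace ℝ (Fin (fixDim L e₀ y₀))) (hy : y ∈ closedBall (0 : EuclideanSpace ℝ (Fin (fixDim L e₀ y₀))) Rv) :
    IntegrableOn (fun z => restWeight (fixCoord y).2 * anchorDensity ωC ωN ωX C₀ N₀ (z, (fixCoord y).1)) Φ volume := by
  obtain ⟨M, hM⟩ := exists_bound_anchorDensity hC hN hCN hX hC₀ hN₀ r hRv
  have ha : (fixCoord y).1 ∈ closedBall (0 : EuclideanSpace ℝ (Fin 3)) Rv :=
    mem_closedBall_zero_iff.2 ((norm_fixCoord_fst_le y).trans (mem_closedBall_zero_iff.1 hy))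
  have hfin : volume Φ ≠ ∞ := (lt_of_le_of_lt (measure_mono hΦ) measure_closedBall_lt_top).ne
  have hmeas : Measurable fun z : EuclideanSpace ℝ (Fin 3) => restWeight (fixCoord y).2 * anchorDensity ωC ωN ωX C₀ N₀ (z, (fixCoord y).1) :=
    measurable_const.mul (measurable_anchorDensity.comp (measurable_id.prodMk measurable_const))
  refine Measure.integrableOn_of_bounded (M := restWeight (fixCoord y).2 * M) hfin hmeas.aestronglyMeasurable ?_
  refine (ae_restrict_iff' hΦm).2 (Filter.Eventually.of_forall fun z hz => ?_)
  rw [Real.norm_eq_abs, abs_of_nonneg (mul_nonneg (restWeight_nonneg _) (anchorDensity_nonneg _))]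
  exact mul_le_mul_of_nonneg_left (hM _ ⟨hΦ hz, ha⟩) (restWeight_nonneg _)

/-! ## §4 The group window has positive finite Haar measure -/

/-- `expMeasure` charges every closed ball of radius `< 1`. [cite: Helgason2000, Ch. I §1 Thm 1.14] -/
theorem expMeasure_closedBall_pos {ρ : ℝ} (hρ : 0 < ρ) (hρ1 : ρ < 1) : 0 < expMeasure (closedBall (0 : EuclideanSpace ℝ (Fin 3)) ρ) := by
  have hρπ : ρ < Real.pi := by linarith [Real.pi_gt_three]
  have hsub : ball (0 : EuclideanSpace ℝ (Fin 3)) ρ ⊆ closedBall (0 : EuclideanSpace ℝ (Fin 3)) ρ ∩ ball 0 Real.pi := fun x hx =>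
    ⟨ball_subset_closedBall hx, ball_subset_ball hρπ.le hx⟩
  have hlow : ∀ x ∈ ball (0 : EuclideanSpace ℝ (Fin 3)) ρ,
      ENNReal.ofReal ((2 * Real.pi ^ 2)⁻¹ * (2 / 3)) ≤ ENNReal.ofReal (expWeight x) := by
    intro x hx
    refine ENNReal.ofReal_le_ofReal ?_
    unfold expWeight
    have hx1 : ‖x‖ ^ 2 ≤ 1 := by
      have h := (mem_ball_zero_iff.1 hx).le.trans hρ1.le
      nlinarith [norm_nonneg x]
    have hs := one_sub_sq_div_three_le_sinc_sq ‖x‖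
    exact mul_le_mul_of_nonneg_left (by linarith) (by positivity)
  rw [expMeasure, withDensity_apply' _ (closedBall (0 : EuclideanSpace ℝ (Fin 3)) ρ), Measure.restrict_restrict measurableSet_closedBall]
  have h1 : ENNReal.ofReal ((2 * Real.pi ^ 2)⁻¹ * (2 / 3)) * volume (ball (0 : EuclideanSpace ℝ (Fin 3)) ρ) ≤
      ∫⁻ x in closedBall (0 : EuclideanSpace ℝ (Fin 3)) ρ ∩ ball 0 Real.pi, ENNReal.ofReal (expWeight x) :=
    calc ENNReal.ofReal ((2 * Real.pi ^ 2)⁻¹ * (2 / 3)) * volume (ball (0 : EuclideanSpace ℝ (Fin 3)) ρ)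
        = ∫⁻ _ in ball (0 : EuclideanSpace ℝ (Fin 3)) ρ, ENNReal.ofReal ((2 * Real.pi ^ 2)⁻¹ * (2 / 3)) := (setLIntegral_const _ _).symm
      _ ≤ ∫⁻ x in ball (0 : EuclideanSpace ℝ (Fin 3)) ρ, ENNReal.ofReal (expWeight x) :=
        setLIntegral_mono measurable_expWeight.ennreal_ofReal hlow
      _ ≤ _ := lintegral_mono_set hsub
  refine lt_of_lt_of_le ?_ h1
  exact ENNReal.mul_pos (ENNReal.ofReal_pos.2 (by positivity)).ne' (Metric.measure_ball_pos volume 0 hρ).ne'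

/-- ★ **`hc0`**: the group window `((expPoint(B̄_ρ))·{1, −1})⁻¹` has positive Haar measure (`0 < ρ < 1`).
[cite: Helgason2000, Ch. I §1 Thm 1.14] [cite: Bredon1972, Ch. II §5] -/
theorem fix_hc0 {ρ : ℝ} (hρ : 0 < ρ) (hρ1 : ρ < 1) :
    haarProbability SU2 (((expPoint '' closedBall (0 : EuclideanSpace ℝ (Fin 3)) ρ) * ({1, negOne} : Set SU2))⁻¹) ≠ 0 := by
  rw [Measure.measure_inv]
  have hsub : expPoint '' closedBall (0 : EuclideanSpace ℝ (Fin 3)) ρ ⊆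
      (expPoint '' closedBall (0 : EuclideanSpace ℝ (Fin 3)) ρ) * ({1, negOne} : Set SU2) :=
    Set.subset_mul_left _ (by simp)
  refine ne_of_gt (lt_of_lt_of_le ?_ (measure_mono hsub))
  rw [← map_expPoint_expMeasure]
  exact lt_of_lt_of_le (expMeasure_closedBall_pos hρ hρ1)
    ((measure_mono (subset_preimage_image _ _)).trans (Measure.le_map_apply measurable_expPoint.aemeasurable _))

/-- **`hctop`**: the group window has finite Haar measure. [folklore] -/
theorem fix_hctop (ρ : ℝ) :
    haarProbability SU2 (((expPoint '' closedBall (0 : EuclideanSpace ℝ (Fin 3)) ρ) * ({1, negOne} : Set SU2))⁻¹) ≠ ∞ :=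
  measure_ne_top _ _

end Summit.QuantumFields.YangMills.Theorems.VirialFluxGap.FixSplit

end
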